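import Literature.NumberTheory.Automorphic.BorelDimension
import Literature.NumberTheory.Automorphic.BorelOfBaseDimension
import Literature.NumberTheory.Automorphic.BigCellOpenProofs
import Literature.NumberTheory.Automorphic.IsomorphismTheoremUniqueLieHolds
import HarnessLib

/-!
# Springer 8.1.3 (ii) and the dimension of `B(b)`, in every characteristic: the discharges
`zdim_borel_and_group_holds`, `zdim_eq_rank_add_card_roots_holds`, `zdim_borelOfBase_holds`
(trunk T-AUTOMORPHIC, G25 AutomorphicL; proof file of the named facts `zdim_borel_and_group`,
`zdim_borelOfBase` of `ReductiveDualChevalleyBasedProofs.lean` and `zdim_eq_rank_add_card_roots` of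
`BigCellOpen.lean` — Springer, *Linear Algebraic Groups*, 2nd ed., Cor. 8.1.3 (ii), p. 133: *"`dim B =
r + ½|R|`, `dim G = r + |R|`, where `r = dim T`"*, and Prop. 8.2.4 (i), proof, p. 139: *"`B̃ = T.U₁`
is a closed, connected, solvable subgroup of `G`, of dimension `dim T + ½|R|`"*; `G` connected
reductive over an algebraically closed field, `T` a maximal torus; the facts quantify over every
characteristic)

Printed proof of 8.1.3 (ii): *"Using 8.1.2 one determines `dim 𝔟` and `dim 𝔤`"* — that is,
`𝔤 = 𝔱 ⊕ ⨁_{α ∈ R} 𝔤_α` with `dim 𝔤_α = 1` (8.1.2) and `𝔟 = 𝔱 ⊕ ⨁_{α ∈ R⁺(B)} 𝔤_α` (7.4.5). The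
tree reduced each of the three named facts to Springer 8.1.2 (the named fact `lieWeights_eq_roots`:
`P = R` and `dim 𝔤_α = 1`) in every characteristic — `zdim_borel_and_group_of_lieWeights_eq_roots`
(`BorelDimension.lean`), `zdim_eq_rank_add_card_roots_of_lieWeights_eq_roots`
(`BigCellOpenProofs.lean`), `zdim_borelOfBase_of_lieWeights_eq_roots` (`BorelOfBaseDimension.lean`,
with `𝔤^T ⊆ L(T)`, the theorem `lieWeightSpace_one_le_lieAlgebraGL_holds`, 5.4.7 / 7.6.4 (ii)) — and
8.1.2 is now a theorem of the tree in every characteristic (`lieWeights_eq_roots_holds`,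
`IsomorphismTheoremUniqueLieHolds.lean`: existence of root homomorphisms in semisimple rank one,
7.3.3 (i)). This file records the three closed discharges. No named fact is introduced and no
statement of the tree is changed.

## References

* [SpringerLAG1998] T. A. Springer, *Linear Algebraic Groups*, 2nd ed., Progress in Mathematics 9,
  Birkhäuser (1998): Cor. 8.1.3 (ii) (p. 133), Cor. 8.1.2 (pp. 132–133), Prop. 8.2.4 (i) proof
  (p. 139) with Lemma 8.2.2, Cor. 5.4.7, Cor. 7.6.4 (ii).
-/

noncomputable section

open scoped MatrixGroups IsMulCommutative

namespace Literature.NumberTheory.Automorphic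

variable {k : Type*} [Field k] {n : Type*} [Fintype n] [DecidableEq n]
variable {ι X Y : Type*} [AddCommGroup X] [AddCommGroup Y]
variable {G T : Subgroup (GL n k)}

/-- **Discharge of `zdim_borel_and_group` (Springer 8.1.3 (ii)), in every characteristic.** For
`G ≤ GL n k` connected reductive over an algebraically closed field, `T` a maximal torus and
`B ⊇ T` a Borel subgroup: `2 dim B = 2 dim T + |R|` and `dim G = dim T + |R|` (`R = roots G T`,
`dim = IsZConnected.zdim`). Proof: `zdim_borel_and_group_of_lieWeights_eq_roots` (the printed
reduction *"using 8.1.2 one determines `dim 𝔟` and `dim 𝔤`"*, applied to `G` and to the centralisers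
`G_α`) with the theorem `lieWeights_eq_roots_holds` (8.1.2).
[cite: SpringerLAG1998, Cor. 8.1.3 (ii) with Cor. 8.1.2] -/
theorem zdim_borel_and_group_holds : zdim_borel_and_group (G := G) (T := T) :=
  zdim_borel_and_group_of_lieWeights_eq_roots fun _ => lieWeights_eq_roots_holds

variable [IsMulCommutative ↥T]

/-- **Discharge of `zdim_eq_rank_add_card_roots` (Springer 8.1.3 (ii), `dim G = r + |R|`), in every
characteristic.** For `G ≤ GL n k` connected reductive over an algebraically closed field, `T` a
maximal torus and `P` (roots indexed by `ι`) the root datum of `(G, T)`: `dim G = dim T + |ι|`.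
Proof: `zdim_eq_rank_add_card_roots_of_lieWeights_eq_roots` (8.1.2 with 7.6.4 (ii), 5.4.7:
`𝔤 = L(T) ⊕ ⨁_{α ∈ P} 𝔤_α`) with the theorem `lieWeights_eq_roots_holds` (8.1.2).
[cite: SpringerLAG1998, Cor. 8.1.3 (ii) with Cor. 8.1.2] -/
theorem zdim_eq_rank_add_card_roots_holds :
    zdim_eq_rank_add_card_roots (ι := ι) (X := X) (Y := Y) G T :=
  zdim_eq_rank_add_card_roots_of_lieWeights_eq_roots lieWeights_eq_roots_holds

/-- **Discharge of `zdim_borelOfBase` (Springer 8.2.4 (i), proof: `dim B̃ = dim T + ½|R|`), in every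
characteristic.** For `G ≤ GL n k` connected reductive over an algebraically closed field, `T` a
maximal torus, `P` the root datum of `(G, T)` and `b` a base: `2 dim B(b) = 2 dim T + |R|` for
`B(b) = ⟨T, U_α : α ∈ R⁺(b)⟩`. Proof: `zdim_borelOfBase_of_lieWeights_eq_roots` (weight-space
decomposition of `Lie B(b)`, in print via 8.2.2) with the theorems `lieWeights_eq_roots_holds` (8.1.2)
and `lieWeightSpace_one_le_lieAlgebraGL_holds` (`𝔤^T ⊆ L(T)`, 5.4.7 with 7.6.4 (ii)).
[cite: SpringerLAG1998, Prop. 8.2.4 (i) proof with Lemma 8.2.2 and Cor. 8.1.2] -/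
theorem zdim_borelOfBase_holds : zdim_borelOfBase (G := G) (T := T) (ι := ι) (X := X) (Y := Y) :=
  zdim_borelOfBase_of_lieWeights_eq_roots lieWeights_eq_roots_holds
    (lieWeightSpace_one_le_lieAlgebraGL_holds G T)

end Literature.NumberTheory.Automorphic
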